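import Literature.NumberTheory.GaloisRepresentations.CoinducedKummerSequencePieces
import HarnessLib

/-!
# The Kummer pieces in degrees `1` and `2`:
# `ψ(𝓗¹(B[p])) = ψ(𝓗⁰(B)/p) + ψ(𝓗¹(B)[p])`, `ψ(𝓗²(B[p])) = ψ(𝓗¹(B)/p) + ψ(𝓗²(B)[p])`

Topic `NumberTheory/GaloisRepresentations` (continuous cochain cohomology); namespace
`Literature.NumberTheory.GaloisRepresentations` (dot notation under `ContinuousRep`).  THEOREMS ONLY
(no definition, no named fact, no `sorry`, no instance).  Sequel of `CoinducedKummerSequencePieces`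
(§1 the Kummer short exact sequence `0 → B[p] → B →(p) B → 0` of a `p`-divisible discrete `G`-module,
§2 degree `0`) and of the instance-polymorphic `ψ`-calculus `AdditiveInvariantExactPieces` (whose
design notes — strict-implicit instance binders in `ψ`, zsmul torsion conditions, submodules entering
through membership characterisations `hN` only — apply verbatim here: the cohomology carriers have a
non-canonical `Module ℤ`).

Setting as there: `G` compact and locally compact, `W ⊴ G` open, `Δ = G ⧸ W`, `ρ` a continuous
representation of `G` on a discrete `B` with `p •` surjective, `𝓗ⁿ(M) = Hⁿ(G, Maps(G ⧸ W, M))` with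
its `Δ`-action by right translations (`coindOpenHRep`; `coindOpenInvariantsRep` in degree `0`).
From the long exact sequence of `0 → Maps(Δ, B[p]) → Maps(Δ, B) →(p) Maps(Δ, B) → 0` and the
`Δ`-equivariance of its maps (`IsSES.δ₀_coindOpenInvariantsRep`, `IsSES.δ₁_coindOpenHRep`,
`coindOpenHRep_cohomologyMap`; exactness from `ContinuousCohomologyConnecting`):

* §3 degree `1`: `finite_continuousCohomology_one_coindOpen_torsionBy` (`𝓗¹(B[p])` is finite when
  `𝓗⁰(B)/p` and `𝓗¹(B)[p]` are) and **`additive_coindOpenHRep_one_torsionBy`**: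
  `ψ(𝓗¹(B[p])) = ψ(𝓗⁰(B)/p) + ψ(𝓗¹(B)[p])`;
* §4 degree `2`: `finite_continuousCohomology_two_coindOpen_torsionBy` and
  **`additive_coindOpenHRep_two_torsionBy`**: `ψ(𝓗²(B[p])) = ψ(𝓗¹(B)/p) + ψ(𝓗²(B)[p])`;

for every invariant `ψ` additive on short exact sequences of finite `p`-torsion `ℤ[Δ]`-modules (the
binder pair of `StableLatticeReductionInvariantInt`, verbatim).  Lane «TATE-EPC-TC» of cell `bsd-eis`
(crux `GoodLatticeBDPValue`, stmt-BirchSwinnertonDyer-19032), brick B8-arith ≡ B6b part (α): with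
`B = E_S`, `B[p] = μ_p` these are `[𝓗¹(μ_p)] = [E_{L,S}/p] + [𝓗¹(E_S)[p]]` and
`[𝓗²(μ_p)] = [𝓗¹(E_S)/p] + [𝓗²(E_S)[p]]` (Milne *ADT* I §5; NSW (8.3.11), (8.7.4)).  HONEST FRAMING:
homological algebra only; no arithmetic statement and no case of BSD is proved here.

## References
* J. Neukirch, A. Schmidt, K. Wingberg, *Cohomology of Number Fields*, 2nd ed. (2008), (1.3.2)–(1.3.3),
  VIII §3. [NeukirchSchmidtWingberg2008]
* R. Greenberg, *On the structure of certain Galois cohomology groups* (2006), §3 B (5). [Greenberg2006]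
* J. S. Milne, *Arithmetic Duality Theorems*, 2nd ed. (2006), I §5 (proof of Thm. 5.1). [MilneADT2006]
* J.-P. Serre, *Corps locaux* (1979), VII §5. [SerreLocalFields1979]
-/

noncomputable section

open CategoryTheory Function Submodule
open scoped Pointwise

universe u

namespace Literature.NumberTheory.GaloisRepresentations

open _root_.TopRep _root_.ContRepresentation _root_.ContinuousCohomology
open Literature.RepresentationTheory.FiniteGroups.StableLatticeReduction (torsionBy_le_comap)
open Literature.RepresentationTheory.FiniteGroups.StableLatticeReduction
  (Poly.finite_of_exact Poly.additive_eq_quotient_add_subrepresentation_of_exact)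

namespace ContinuousRep

variable {G : Type u} [Group G] [TopologicalSpace G] [IsTopologicalGroup G] [CompactSpace G]
  [LocallyCompactSpace G]
variable {B : Type u} [AddCommGroup B] [TopologicalSpace B] [DiscreteTopology B]
variable (ρ : ContinuousRep G ℤ B) (W : Subgroup G) [W.Normal] (hW : IsOpen (W : Set G)) (p : ℕ)

variable {A : Type*} [AddCommGroup A]
variable (ψ : ∀ ⦃X : Type u⦄ ⦃_ : AddCommGroup X⦄ ⦃_ : Module ℤ X⦄, Representation ℤ (G ⧸ W) X → A)
  (hψ : ∀ ⦃X Y Z : Type u⦄ [AddCommGroup X] [Module ℤ X] [AddCommGroup Y] [Module ℤ Y]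
    [AddCommGroup Z] [Module ℤ Z] (ρX : Representation ℤ (G ⧸ W) X) (ρY : Representation ℤ (G ⧸ W) Y)
    (ρZ : Representation ℤ (G ⧸ W) Z) (f : X →ₗ[ℤ] Y) (g : Y →ₗ[ℤ] Z),
    (∀ s x, f (ρX s x) = ρY s (f x)) → (∀ s y, g (ρY s y) = ρZ s (g y)) →
    Injective f → Surjective g → LinearMap.range f = LinearMap.ker g → Finite Y →
    (∀ y : Y, (p : ℤ) • y = 0) → ψ ρY = ψ ρX + ψ ρZ)

/-! ## §3 Degree `1` -/

section DegreeOne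

omit [LocallyCompactSpace G] [W.Normal] in
/-- The three exactness facts of `𝓗⁰(B) →(p) 𝓗⁰(B) →δ₀ 𝓗¹(B[p]) → 𝓗¹(B) →(p) 𝓗¹(B)` for the Kummer
morphisms `ι`, `μ` read through `Maps(Δ, –)`: `ker δ₀ = p 𝓗⁰(B)`, `im δ₀ = ker 𝓗¹(ι)`,
`im 𝓗¹(ι) = 𝓗¹(B)[p]`. [cite: NeukirchSchmidtWingberg2008, (1.3.2)] [cite: Greenberg2006, §3 B (5)] -/
theorem kummer_exact_one
    (ι : (ρ.subrepresentation (torsionBy ℤ B (p : ℤ)) (torsionBy_le_comap ρ.toRepresentation (p : ℤ))).toTopRep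
      ⟶ ρ.toTopRep) (hι : ∀ w, ι.hom w = (w : B))
    (μ : ρ.toTopRep ⟶ ρ.toTopRep) (hμ : ∀ b, μ.hom b = (p : ℤ) • b) (h : IsSES ι μ)
    [DiscreteTopology (G ⧸ W → B)] [DiscreteTopology (G ⧸ W → torsionBy ℤ B (p : ℤ))] :
    (∀ v : (ρ.coindOpen W hW).toTopRep.ρ.invariants, (h.coindOpenMap W hW).δ₀ v = 0 ↔
        ∃ w : (ρ.coindOpen W hW).toTopRep.ρ.invariants, (p : ℤ) • w = v) ∧
      (∀ q : continuousCohomology 1 (((ρ.subrepresentation (torsionBy ℤ B (p : ℤ))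
          (torsionBy_le_comap ρ.toRepresentation (p : ℤ))).coindOpen W hW).toTopRep),
        (cohomologyMap (((ρ.subrepresentation (torsionBy ℤ B (p : ℤ))
          (torsionBy_le_comap ρ.toRepresentation (p : ℤ))).coindOpenMap ρ W hW ι)) 1).hom q = 0 ↔
          ∃ v, (h.coindOpenMap W hW).δ₀ v = q) ∧
      (∀ t : continuousCohomology 1 (ρ.coindOpen W hW).toTopRep,
        (∃ q, (cohomologyMap (((ρ.subrepresentation (torsionBy ℤ B (p : ℤ))
          (torsionBy_le_comap ρ.toRepresentation (p : ℤ))).coindOpenMap ρ W hW ι)) 1).hom q = t) ↔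
          (p : ℤ) • t = 0) := by
  have h' := h.coindOpenMap W hW
  refine ⟨fun v => ?_, fun q => ?_, fun t => ?_⟩
  · rw [h'.δ₀_eq_zero_iff]
    constructor
    · rintro ⟨w, hw, hwv⟩
      refine ⟨⟨w, hw⟩, Subtype.ext ?_⟩
      rw [coe_smul, ← hwv]
      funext y
      change ((p : ℤ) • w) y = μ.hom (w y)
      rw [hμ, Pi.smul_apply]
    · rintro ⟨w, rfl⟩
      refine ⟨(w : G ⧸ W → B), w.2, funext fun y => ?_⟩
      change μ.hom ((w : G ⧸ W → B) y) = ((p : ℤ) • (w : G ⧸ W → B)) y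
      rw [hμ, Pi.smul_apply]
  · constructor
    · intro hq
      exact h'.exists_δ₀_eq_of_map_one_eq_zero q hq
    · rintro ⟨v, rfl⟩
      exact h'.map_one_δ₀ v
  · constructor
    · rintro ⟨q, rfl⟩
      rw [← ρ.cohomologyMap_coindOpenMap_smul_apply W hW p μ hμ 1]
      exact cohomologyMap_comp_apply_of_zero _ _
        (fun φ => ρ.coindOpenMap_smul_coindOpenMap_incl_apply W hW p ι hι μ hμ φ) 1 q
    · intro ht
      rw [← ρ.cohomologyMap_coindOpenMap_smul_apply W hW p μ hμ 1] at ht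
      exact h'.exists_map_one_eq_of_map_one_eq_zero t ht

omit [LocallyCompactSpace G] [W.Normal] in
/-- **`𝓗¹(B[p])` is finite when `𝓗⁰(B)/p` and `𝓗¹(B)[p]` are.**
[cite: NeukirchSchmidtWingberg2008, (1.3.2)] [cite: MilneADT2006, I §5 (proof of Thm. 5.1)] -/
theorem finite_continuousCohomology_one_coindOpen_torsionBy
    (hdiv : Surjective fun b : B => (p : ℤ) • b)
    (N₀ : Submodule ℤ (ρ.coindOpen W hW).toTopRep.ρ.invariants)
    (hN₀ : ∀ v, v ∈ N₀ ↔ ∃ w : (ρ.coindOpen W hW).toTopRep.ρ.invariants, (p : ℤ) • w = v)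
    [Finite ((ρ.coindOpen W hW).toTopRep.ρ.invariants ⧸ N₀)]
    (N₁ : Submodule ℤ (continuousCohomology 1 (ρ.coindOpen W hW).toTopRep))
    (hN₁ : ∀ t, t ∈ N₁ ↔ (p : ℤ) • t = 0) [hN₁fin : Finite N₁] :
    Finite (continuousCohomology 1 (((ρ.subrepresentation (torsionBy ℤ B (p : ℤ))
      (torsionBy_le_comap ρ.toRepresentation (p : ℤ))).coindOpen W hW).toTopRep)) := by
  haveI : DiscreteTopology (G ⧸ W → B) := discreteTopology_coindOpen W hW
  haveI : DiscreteTopology (G ⧸ W → torsionBy ℤ B (p : ℤ)) := discreteTopology_coindOpen W hW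
  obtain ⟨ι, μ, hι, hμ, h⟩ := ρ.exists_kummer_isSES p hdiv
  obtain ⟨hker, hex, hrange⟩ := ρ.kummer_exact_one W hW p ι hι μ hμ h
  set f := (cohomologyMap (((ρ.subrepresentation (torsionBy ℤ B (p : ℤ))
    (torsionBy_le_comap ρ.toRepresentation (p : ℤ))).coindOpenMap ρ W hW ι)) 1).hom.toLinearMap
    with hf
  have hle : N₀ ≤ LinearMap.ker (h.coindOpenMap W hW).δ₀ := fun v hv => (hker v).2 ((hN₀ v).1 hv)
  haveI : Finite (AddMonoidHom.range f.toAddMonoidHom) := by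
    have hset : (AddMonoidHom.range f.toAddMonoidHom : Set _) = SetLike.coe N₁ := by
      ext t
      rw [SetLike.mem_coe, SetLike.mem_coe, AddMonoidHom.mem_range, hN₁]
      exact hrange t
    exact (Set.finite_coe_iff.2 ((Set.finite_coe_iff.1 hN₁fin).subset hset.le) :)
  exact Poly.finite_of_exact (N₀.liftQ _ hle).toAddMonoidHom f.toAddMonoidHom (fun q hq => by
    obtain ⟨v, hv⟩ := (hex q).1 hq
    exact ⟨Submodule.Quotient.mk v, hv⟩)

omit [LocallyCompactSpace G] in
include hψ in
/-- **The degree-one Kummer piece, `ψ`-form: `ψ(𝓗¹(B[p])) = ψ(𝓗⁰(B)/p) + ψ(𝓗¹(B)[p])`** (the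
`Δ`-equivariant short exact sequence `0 → 𝓗⁰(B)/p →δ₀ 𝓗¹(B[p]) → 𝓗¹(B)[p] → 0`), for every additive
invariant `ψ` of finite `p`-torsion `ℤ[Δ]`-modules, `𝓗¹(B[p])` finite.
[cite: NeukirchSchmidtWingberg2008, (1.3.2)–(1.3.3)] [cite: MilneADT2006, I §5 (proof of Thm. 5.1)]
[cite: Greenberg2006, §3 B (5)] -/
theorem additive_coindOpenHRep_one_torsionBy (hdiv : Surjective fun b : B => (p : ℤ) • b)
    (N₀ : Submodule ℤ (ρ.coindOpen W hW).toTopRep.ρ.invariants)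
    (hN₀ : ∀ v, v ∈ N₀ ↔ ∃ w : (ρ.coindOpen W hW).toTopRep.ρ.invariants, (p : ℤ) • w = v)
    (hN₀st : ∀ c, N₀ ≤ N₀.comap (ρ.coindOpenInvariantsRep W hW c))
    (N₁ : Submodule ℤ (continuousCohomology 1 (ρ.coindOpen W hW).toTopRep))
    (hN₁ : ∀ t, t ∈ N₁ ↔ (p : ℤ) • t = 0) (hN₁st : ∀ c, N₁ ≤ N₁.comap (ρ.coindOpenHRep W hW 1 c))
    [Finite (continuousCohomology 1 (((ρ.subrepresentation (torsionBy ℤ B (p : ℤ))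
      (torsionBy_le_comap ρ.toRepresentation (p : ℤ))).coindOpen W hW).toTopRep))] :
    ψ (((ρ.subrepresentation (torsionBy ℤ B (p : ℤ))
        (torsionBy_le_comap ρ.toRepresentation (p : ℤ))).coindOpenHRep W hW 1)) =
      ψ ((ρ.coindOpenInvariantsRep W hW).quotient N₀ hN₀st) +
        ψ ((ρ.coindOpenHRep W hW 1).subrepresentation N₁ hN₁st) := by
  haveI : DiscreteTopology (G ⧸ W → B) := discreteTopology_coindOpen W hW
  haveI : DiscreteTopology (G ⧸ W → torsionBy ℤ B (p : ℤ)) := discreteTopology_coindOpen W hW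
  obtain ⟨ι, μ, hι, hμ, h⟩ := ρ.exists_kummer_isSES p hdiv
  obtain ⟨hker, hex, hrange⟩ := ρ.kummer_exact_one W hW p ι hι μ hμ h
  exact Poly.additive_eq_quotient_add_subrepresentation_of_exact ψ hψ _ _ _
    (h.coindOpenMap W hW).δ₀ (cohomologyMap ((ρ.subrepresentation (torsionBy ℤ B (p : ℤ))
      (torsionBy_le_comap ρ.toRepresentation (p : ℤ))).coindOpenMap ρ W hW ι) 1).hom.toLinearMap
    (fun c v => h.δ₀_coindOpenInvariantsRep W hW c v)
    (fun c q => ((ρ.subrepresentation (torsionBy ℤ B (p : ℤ))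
      (torsionBy_le_comap ρ.toRepresentation (p : ℤ))).coindOpenHRep_cohomologyMap ρ W hW ι 1 c q).symm)
    N₀ hN₀st N₁ hN₁st (fun v => (hker v).trans (hN₀ v).symm) hex
    (fun t => (hrange t).trans (hN₁ t).symm)
    (fun q => ρ.zsmul_coindOpen_torsionBy_eq_zero W hW p 1 q)

end DegreeOne

/-! ## §4 Degree `2` -/

section DegreeTwo

omit [W.Normal] in
/-- The three exactness facts of `𝓗¹(B) →(p) 𝓗¹(B) →δ₁ 𝓗²(B[p]) → 𝓗²(B) →(p) 𝓗²(B)`: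
`ker δ₁ = p 𝓗¹(B)`, `im δ₁ = ker 𝓗²(ι)`, `im 𝓗²(ι) = 𝓗²(B)[p]`.
[cite: NeukirchSchmidtWingberg2008, (1.3.2)] [cite: Greenberg2006, §3 B (5)] -/
theorem kummer_exact_two
    (ι : (ρ.subrepresentation (torsionBy ℤ B (p : ℤ)) (torsionBy_le_comap ρ.toRepresentation (p : ℤ))).toTopRep
      ⟶ ρ.toTopRep) (hι : ∀ w, ι.hom w = (w : B))
    (μ : ρ.toTopRep ⟶ ρ.toTopRep) (hμ : ∀ b, μ.hom b = (p : ℤ) • b) (h : IsSES ι μ)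
    [DiscreteTopology (G ⧸ W → B)] [DiscreteTopology (G ⧸ W → torsionBy ℤ B (p : ℤ))] :
    (∀ x : continuousCohomology 1 (ρ.coindOpen W hW).toTopRep, (h.coindOpenMap W hW).δ₁ x = 0 ↔
        ∃ y : continuousCohomology 1 (ρ.coindOpen W hW).toTopRep, (p : ℤ) • y = x) ∧
      (∀ q : continuousCohomology 2 (((ρ.subrepresentation (torsionBy ℤ B (p : ℤ))
          (torsionBy_le_comap ρ.toRepresentation (p : ℤ))).coindOpen W hW).toTopRep),
        (cohomologyMap (((ρ.subrepresentation (torsionBy ℤ B (p : ℤ))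
          (torsionBy_le_comap ρ.toRepresentation (p : ℤ))).coindOpenMap ρ W hW ι)) 2).hom q = 0 ↔
          ∃ x, (h.coindOpenMap W hW).δ₁ x = q) ∧
      (∀ t : continuousCohomology 2 (ρ.coindOpen W hW).toTopRep,
        (∃ q, (cohomologyMap (((ρ.subrepresentation (torsionBy ℤ B (p : ℤ))
          (torsionBy_le_comap ρ.toRepresentation (p : ℤ))).coindOpenMap ρ W hW ι)) 2).hom q = t) ↔
          (p : ℤ) • t = 0) := by
  have h' := h.coindOpenMap W hW
  refine ⟨fun x => ?_, fun q => ?_, fun t => ?_⟩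
  · constructor
    · intro hx
      obtain ⟨y, hy⟩ := h'.exists_map_one_eq_of_δ₁_eq_zero x hx
      refine ⟨y, ?_⟩
      rw [← hy]
      exact (ρ.cohomologyMap_coindOpenMap_smul_apply W hW p μ hμ 1 y).symm
    · rintro ⟨y, rfl⟩
      rw [← ρ.cohomologyMap_coindOpenMap_smul_apply W hW p μ hμ 1 y]
      exact h'.δ₁_map_one y
  · constructor
    · intro hq
      exact h'.exists_δ₁_eq_of_map_two_eq_zero q hq
    · rintro ⟨x, rfl⟩
      exact h'.map_two_δ₁ x
  · constructor
    · rintro ⟨q, rfl⟩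
      rw [← ρ.cohomologyMap_coindOpenMap_smul_apply W hW p μ hμ 2]
      exact cohomologyMap_comp_apply_of_zero _ _
        (fun φ => ρ.coindOpenMap_smul_coindOpenMap_incl_apply W hW p ι hι μ hμ φ) 2 q
    · intro ht
      rw [← ρ.cohomologyMap_coindOpenMap_smul_apply W hW p μ hμ 2] at ht
      exact h'.exists_map_two_eq_of_map_two_eq_zero t ht

omit [W.Normal] in
/-- **`𝓗²(B[p])` is finite when `𝓗¹(B)/p` and `𝓗²(B)[p]` are.**
[cite: NeukirchSchmidtWingberg2008, (1.3.2)] [cite: MilneADT2006, I §5 (proof of Thm. 5.1)] -/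
theorem finite_continuousCohomology_two_coindOpen_torsionBy
    (hdiv : Surjective fun b : B => (p : ℤ) • b)
    (N₁ : Submodule ℤ (continuousCohomology 1 (ρ.coindOpen W hW).toTopRep))
    (hN₁ : ∀ x, x ∈ N₁ ↔ ∃ y : continuousCohomology 1 (ρ.coindOpen W hW).toTopRep, (p : ℤ) • y = x)
    [Finite (continuousCohomology 1 (ρ.coindOpen W hW).toTopRep ⧸ N₁)]
    (N₂ : Submodule ℤ (continuousCohomology 2 (ρ.coindOpen W hW).toTopRep))
    (hN₂ : ∀ t, t ∈ N₂ ↔ (p : ℤ) • t = 0) [hN₂fin : Finite N₂] :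
    Finite (continuousCohomology 2 (((ρ.subrepresentation (torsionBy ℤ B (p : ℤ))
      (torsionBy_le_comap ρ.toRepresentation (p : ℤ))).coindOpen W hW).toTopRep)) := by
  haveI : DiscreteTopology (G ⧸ W → B) := discreteTopology_coindOpen W hW
  haveI : DiscreteTopology (G ⧸ W → torsionBy ℤ B (p : ℤ)) := discreteTopology_coindOpen W hW
  obtain ⟨ι, μ, hι, hμ, h⟩ := ρ.exists_kummer_isSES p hdiv
  obtain ⟨hker, hex, hrange⟩ := ρ.kummer_exact_two W hW p ι hι μ hμ h
  set f := (cohomologyMap (((ρ.subrepresentation (torsionBy ℤ B (p : ℤ))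
    (torsionBy_le_comap ρ.toRepresentation (p : ℤ))).coindOpenMap ρ W hW ι)) 2).hom.toLinearMap
    with hf
  have hle : N₁ ≤ LinearMap.ker (h.coindOpenMap W hW).δ₁ := fun v hv => (hker v).2 ((hN₁ v).1 hv)
  haveI : Finite (AddMonoidHom.range f.toAddMonoidHom) := by
    have hset : (AddMonoidHom.range f.toAddMonoidHom : Set _) = SetLike.coe N₂ := by
      ext t
      rw [SetLike.mem_coe, SetLike.mem_coe, AddMonoidHom.mem_range, hN₂]
      exact hrange t
    exact (Set.finite_coe_iff.2 ((Set.finite_coe_iff.1 hN₂fin).subset hset.le) :)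
  exact Poly.finite_of_exact (N₁.liftQ _ hle).toAddMonoidHom f.toAddMonoidHom (fun q hq => by
    obtain ⟨v, hv⟩ := (hex q).1 hq
    exact ⟨Submodule.Quotient.mk v, hv⟩)

include hψ in
/-- **The degree-two Kummer piece, `ψ`-form: `ψ(𝓗²(B[p])) = ψ(𝓗¹(B)/p) + ψ(𝓗²(B)[p])`** (the
`Δ`-equivariant short exact sequence `0 → 𝓗¹(B)/p →δ₁ 𝓗²(B[p]) → 𝓗²(B)[p] → 0`), for every additive
invariant `ψ` of finite `p`-torsion `ℤ[Δ]`-modules, `𝓗²(B[p])` finite.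
[cite: NeukirchSchmidtWingberg2008, (1.3.2)–(1.3.3)] [cite: MilneADT2006, I §5 (proof of Thm. 5.1)]
[cite: Greenberg2006, §3 B (5)] -/
theorem additive_coindOpenHRep_two_torsionBy (hdiv : Surjective fun b : B => (p : ℤ) • b)
    (N₁ : Submodule ℤ (continuousCohomology 1 (ρ.coindOpen W hW).toTopRep))
    (hN₁ : ∀ x, x ∈ N₁ ↔ ∃ y : continuousCohomology 1 (ρ.coindOpen W hW).toTopRep, (p : ℤ) • y = x)
    (hN₁st : ∀ c, N₁ ≤ N₁.comap (ρ.coindOpenHRep W hW 1 c))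
    (N₂ : Submodule ℤ (continuousCohomology 2 (ρ.coindOpen W hW).toTopRep))
    (hN₂ : ∀ t, t ∈ N₂ ↔ (p : ℤ) • t = 0) (hN₂st : ∀ c, N₂ ≤ N₂.comap (ρ.coindOpenHRep W hW 2 c))
    [Finite (continuousCohomology 2 (((ρ.subrepresentation (torsionBy ℤ B (p : ℤ))
      (torsionBy_le_comap ρ.toRepresentation (p : ℤ))).coindOpen W hW).toTopRep))] :
    ψ (((ρ.subrepresentation (torsionBy ℤ B (p : ℤ))
        (torsionBy_le_comap ρ.toRepresentation (p : ℤ))).coindOpenHRep W hW 2)) =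
      ψ ((ρ.coindOpenHRep W hW 1).quotient N₁ hN₁st) +
        ψ ((ρ.coindOpenHRep W hW 2).subrepresentation N₂ hN₂st) := by
  haveI : DiscreteTopology (G ⧸ W → B) := discreteTopology_coindOpen W hW
  haveI : DiscreteTopology (G ⧸ W → torsionBy ℤ B (p : ℤ)) := discreteTopology_coindOpen W hW
  obtain ⟨ι, μ, hι, hμ, h⟩ := ρ.exists_kummer_isSES p hdiv
  obtain ⟨hker, hex, hrange⟩ := ρ.kummer_exact_two W hW p ι hι μ hμ h
  exact Poly.additive_eq_quotient_add_subrepresentation_of_exact ψ hψ _ _ _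
    (h.coindOpenMap W hW).δ₁ (cohomologyMap ((ρ.subrepresentation (torsionBy ℤ B (p : ℤ))
      (torsionBy_le_comap ρ.toRepresentation (p : ℤ))).coindOpenMap ρ W hW ι) 2).hom.toLinearMap
    (fun c x => h.δ₁_coindOpenHRep W hW c x)
    (fun c q => ((ρ.subrepresentation (torsionBy ℤ B (p : ℤ))
      (torsionBy_le_comap ρ.toRepresentation (p : ℤ))).coindOpenHRep_cohomologyMap ρ W hW ι 2 c q).symm)
    N₁ hN₁st N₂ hN₂st (fun x => (hker x).trans (hN₁ x).symm) hex
    (fun t => (hrange t).trans (hN₂ t).symm)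
    (fun q => ρ.zsmul_coindOpen_torsionBy_eq_zero W hW p 2 q)

end DegreeTwo

end ContinuousRep

end Literature.NumberTheory.GaloisRepresentations

end
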